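import Summits.FinalStateConjecture.FinalStateConjecture.Theses.LaminatedThreshold

/-!
# Crux `LaminatedThreshold` — line `Sketch` (= idea `extremal-comb-nhek-echo`, crux-ideate r1 k2):
# EXTREMAL-COMB SKELETON (line lead c1, 2026-08-17)

Crux item `stmt-FinalStateConjecture-16893`, decl (FIXED, concluded BY NAME in `LaminatedThreshold_of`):
`Summit.FinalStateConjecture.FinalStateConjecture.Theses.LaminatedThreshold.LaminatedThreshold`.

The payload line `Sketch` is the crux-ideate k2 sketch (`…T102036Z-Sketch.lean`, evidence-only, not in the
crux directory and not mounted in the lead's jail); its cut is reconstructed here VERBATIM FROM ITS CARD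
`Cruxes/LaminatedThreshold/Ideas/extremal-comb-nhek-echo.md` (§First lemma, §Transfer):

* `stub_extremalComb` (`C⁺ := ExtremalComb`): the crux's `(X, d⋆, Φ, K)`-clause with the conclusion
  "`F c` exceptional" replaced by "`F c` SETTLES EXTREMALLY" — some MAXIMAL vacuum Cauchy development of
  `F c` carries an HONEST decomposition (`O = exteriorOf 𝒟 d.charted`, `RaysStayInClosure`,
  `HasExhaustiveCharts`, `IsFutureOriented`) with an EXTREMAL hole `|aᵢ| = Mᵢ` (allowed by
  `FinalStateDecomposition.abs_spin_le_mass`, excluded from "good" only by `Kerr.IsSubextremal`). Intended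
  engine: Dafermos's chaotic near-extremal moduli picture (GRG 57 (2025) §6.4, Fig. 7) driven by the
  complex NHEK weights; base point = a vacuum extremal-critical-collapse datum (Kehle–Unger
  arXiv:2402.10190, Conj. 5 — OPEN). [open-problem]
* `stub_extremalLeafNotGood` (`ExtremalLeafNotGood`, the card's First lemma): KERR-PARAMETER RIGIDITY OF
  HONEST DECOMPOSITIONS — a maximal vacuum Cauchy development of an admissible datum that carries an honest
  decomposition with an extremal hole carries NO honest decomposition all of whose holes are sub-extremal.
  [L–XL; no parameter-uniqueness / intrinsic-DOC lemma in the tree]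

Composition `LaminatedThreshold_of` (kernel-checked, no `sorry` of its own): exactly the `birth`
composition with `not_isGood_of_settlesExtremal` in place of `not_isGood_of_isNakedDatum`; "`d⋆` is
exceptional" is read off the saturation clause along the constant family.

## Disproof used
`Cruxes/LaminatedThreshold/Disproof.lean` (cdisprove cycle-1 final, v3): §1 `Negative/HalfExitKills`
(p159240) — the base point `d⋆` of Stub 1 must have NO one-sided good window along any local direction,
so an ACCESSIBLE threshold point (reached from the prompt-sub-extremal side along a local curve) can never
be `d⋆`; §2/§5 (continuity and two-sidedness load-bearing) are kept verbatim in Stub 1; no `-- Targets`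
on these stubs. `Negative/CagedCarrierIsNakedLamination` (p161008) is the template of this line's weakness:
Stub 1 is the crux in "settles-extremal" costume (see `exists_settlesExtremal_of_stub_extremalComb`).
-/

noncomputable section

-- the doubled `FinalStateConjecture.FinalStateConjecture` path component trips dupNamespace
set_option linter.dupNamespace false

namespace Summit.FinalStateConjecture.FinalStateConjecture.Cruxes.LaminatedThreshold.ExtremalComb

open Set Filter Function Topology TopologicalSpace
open scoped Manifold ContDiff
open Literature.Geometry.Lorentzian
open Summit.FinalStateConjecture.FinalStateConjecture.Theses.LaminatedThreshold

/-! ## §0 Vocabulary of the proof (NOT used inside stub signatures, which are fully expanded) -/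

section Vocabulary

variable {X : Type} [TopologicalSpace X] [ChartedSpace E3 X] [IsManifold (𝓡 3) ∞ X] [T2Space X]
  [SecondCountableTopology X] [ConnectedSpace X]

/-- **Good in the re-typed sense** (verbatim the summit's property at a datum `D`): an MGHD exists, and
every MGHD has complete `𝓘⁺` and settles down. [cite: DafermosLuk2017, Conjecture 1] -/
def IsGood (D : InitialDataSet (𝓡 3) X) : Prop :=
  (∃ 𝒟 : Literature.Geometry.Lorentzian.VacuumCauchyDevelopment D, 𝒟.IsMaximal) ∧ ∀ 𝒟 : Literature.Geometry.Lorentzian.VacuumCauchyDevelopment D, 𝒟.IsMaximal → Summit.FinalStateConjecture.HasCompleteNullInfinity 𝒟.toCauchyDevelopment ∧ ∃ (O : Set 𝒟.carrier) (d : Literature.Geometry.Lorentzian.FinalStateDecomposition 𝒟.toSpacetime O 2), (∀ i, Literature.Geometry.Lorentzian.Kerr.IsSubextremal (d.mass i) (d.spin i)) ∧ O = Summit.FinalStateConjecture.exteriorOf 𝒟.toCauchyDevelopment d.charted ∧ Summit.FinalStateConjecture.RaysStayInClosure 𝒟.toCauchyDevelopment O ∧ Summit.FinalStateConjecture.HasExhaustiveCharts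 d ∧ Summit.FinalStateConjecture.IsFutureOriented d

/-- **Honest decomposition** of the region `O` of the maximal development `𝒟`: the four audit clauses
of the summit (`O` self-determined, ray-closed, exhaustively charted, future-oriented).
[cite: DafermosLuk2017, Conjecture 1] -/
def IsHonest {D : InitialDataSet (𝓡 3) X} (𝒟 : Literature.Geometry.Lorentzian.VacuumCauchyDevelopment D)
    (O : Set 𝒟.carrier) (d : Literature.Geometry.Lorentzian.FinalStateDecomposition 𝒟.toSpacetime O 2) : Prop :=
  O = Summit.FinalStateConjecture.exteriorOf 𝒟.toCauchyDevelopment d.charted ∧ Summit.FinalStateConjecture.RaysStayInClosure 𝒟.toCauchyDevelopment O ∧ Summit.FinalStateConjecture.HasExhaustiveCharts d ∧ Summit.FinalStateConjecture.IsFutureOriented d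

/-- **`D` settles extremally**: some MAXIMAL vacuum Cauchy development of `D` carries an honest `C²`
decomposition with an extremal hole `|aᵢ| = Mᵢ`. [cite: Dafermos2025GRG, §6.4] -/
def SettlesExtremal (D : InitialDataSet (𝓡 3) X) : Prop :=
  ∃ 𝒟 : Literature.Geometry.Lorentzian.VacuumCauchyDevelopment D, 𝒟.IsMaximal ∧ ∃ (O : Set 𝒟.carrier) (d : Literature.Geometry.Lorentzian.FinalStateDecomposition 𝒟.toSpacetime O 2), IsHonest 𝒟 O d ∧ ∃ i, |d.spin i| = d.mass i

end Vocabulary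

/-! ## §1 The two statements of the line (named; nothing here is a route item) -/

/-- **THE EXTREMAL COMB** (`stub_extremalComb`; dynamics + base point): there are `X`, an admissible
vacuum datum `d⋆`, a functional `Φ` and `K ⊆ ℝ` with `Φ d⋆ ∈ K` a TWO-SIDED accumulation point of `K`,
such that along every jointly smooth admissible family through `d⋆` supported in one compact set, `Φ ∘ F`
is continuous on a `δ`-ball and every member there with `Φ (F c) ∈ K` SETTLES EXTREMALLY (some maximal
vacuum Cauchy development carries an honest `C²` decomposition with a hole `|aᵢ| = Mᵢ`). Intended
mechanism: along the transversal coordinate `s` (spin excess of a primary extremal threshold) the outcomes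
prompt-sub-extremal collapse / horizon jump alternate infinitely often as `s → 0±` (log-periodic NHEK towers,
complex weights `½ ± iδ`), each switch pinning an extremal-settling sheet: `Φ = s`, `K = {0} ∪ {s_n^±}`.
Why it might fail: Dafermos Conj. 6.1/6.2 (codimension-one stability of extremal Kerr, no chaotic region)
may hold, as its spherical analogue does (Angelopoulos–Kehle–Unger 2026); and no admissible vacuum datum is
KNOWN to settle extremally (Kehle–Unger Conj. 5, open). [cite: Dafermos2025GRG, §6.4]
[cite: KehleUnger2024, Conj. 5] -/
def ExtremalComb : Prop :=
  ∃ (X : Type) (_ : TopologicalSpace X) (_ : ChartedSpace Literature.Geometry.Lorentzian.E3 X) (_ : IsManifold (𝓡 3) ((⊤ : ℕ∞) : WithTop ℕ∞) X) (_ : T2Space X) (_ : SecondCountableTopology X) (_ : ConnectedSpace X) (dstar : Literature.Geometry.Lorentzian.InitialDataSet (𝓡 3) X) (Φ : Literature.Geometry.Lorentzian.InitialDataSet (𝓡 3) X → ℝ) (K : Set ℝ), dstar ∈ Literature.Geometry.Lorentzian.admissibleVacuumData X ∧ Φ dstar ∈ K ∧ (∀ ε : ℝ, 0 < ε → (K ∩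 Set.Ioo (Φ dstar - ε) (Φ dstar)).Nonempty ∧ (K ∩ Set.Ioo (Φ dstar) (Φ dstar + ε)).Nonempty) ∧ ∀ F : EuclideanSpace ℝ (Fin 1) → Literature.Geometry.Lorentzian.InitialDataSet (𝓡 3) X, Literature.Geometry.Lorentzian.InitialDataSet.IsSmoothDataFamily 1 F → F 0 = dstar → (∀ c, F c ∈ Literature.Geometry.Lorentzian.admissibleVacuumData X) → (∃ C : Set X, IsCompact C ∧ ∀ c, ∀ x ∉ C, (F c).h.inner x = dstar.h.inner x ∧ (F c).k x = dstar.k x) → ∃ δ : ℝ, 0 < δ ∧ ContinuousOn (fun c ↦ Φ (F c)) (Metric.ball 0 δ) ∧ ∀ c ∈ Metric.ball (0 : EuclideanSpace ℝ (Fin 1)) δ, Φ (F c) ∈ K → ∃ 𝒟 : Literature.Geometry.Lorentzian.VacuumCauchyDevelopment (F c), 𝒟.IsMaximal ∧ ∃ (O : Set 𝒟.carrier) (d : Literature.Geometry.Lorentzian.FinalStateDecomposition 𝒟.toSpacetime O 2), (O = Summit.FinalStateConjecture.exteriorOf 𝒟.toCauchyDevelopment d.charted ∧ Summit.FinalStateConjecture.RaysStayInClosure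 𝒟.toCauchyDevelopment O ∧ Summit.FinalStateConjecture.HasExhaustiveCharts d ∧ Summit.FinalStateConjecture.IsFutureOriented d) ∧ ∃ i, |d.spin i| = d.mass i

/-- **EXTREMAL LEAVES ARE NOT GOOD** (`stub_extremalLeafNotGood`; Kerr-parameter rigidity of honest
decompositions, late-time Lorentzian geometry): for every `X`, every admissible vacuum datum `D` on `X`
and every MAXIMAL vacuum Cauchy development `𝒟` of `D` carrying an honest `C²` decomposition with an
extremal hole `|aᵢ| = Mᵢ`, there is NO honest `C²` decomposition of `𝒟` all of whose holes are
sub-extremal. Proof route of the card (size L–XL, new brick): threshold rays between capture and escape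
are future-complete normalised null rays asymptotic to the retrograde photon orbit of hole `i`, so
`RaysStayInClosure` puts their late events in `closure O'`; `HasExhaustiveCharts d'` forces a hole chart
`j` of `d'` to certify them (the flat chart cannot: curvature `≍ Mᵢ⁻²`); two `C²` Kerr limits of one
region agree in their curvature invariants, hence `(M'ⱼ, |a'ⱼ|) = (Mᵢ, Mᵢ)`, contradicting `|a'ⱼ| < M'ⱼ`.
Why it might fail as typed: none of "the DOC is intrinsic" (`closure O = closure O'`), "late near-horizon
events are certified by a hole chart", "Kerr truncated slabs are `C²`-rigid in `(M, |a|)`" is in the tree.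
[cite: DafermosLuk2017, Conjecture 1] [cite: Dafermos2025GRG, §6.4] -/
def ExtremalLeafNotGood : Prop :=
  ∀ (X : Type) [TopologicalSpace X] [ChartedSpace Literature.Geometry.Lorentzian.E3 X] [IsManifold (𝓡 3) ((⊤ : ℕ∞) : WithTop ℕ∞) X] [T2Space X] [SecondCountableTopology X] [ConnectedSpace X], ∀ D ∈ Literature.Geometry.Lorentzian.admissibleVacuumData X, ∀ 𝒟 : Literature.Geometry.Lorentzian.VacuumCauchyDevelopment D, 𝒟.IsMaximal → (∃ (O : Set 𝒟.carrier) (d : Literature.Geometry.Lorentzian.FinalStateDecomposition 𝒟.toSpacetime O 2), (O = Summit.FinalStateConjecture.exteriorOf 𝒟.toCauchyDevelopment d.charted ∧ Summit.FinalStateConjecture.RaysStayInClosure 𝒟.toCauchyDevelopment O ∧ Summit.FinalStateConjecture.HasExhaustiveCharts d ∧ Summit.FinalStateConjecture.IsFutureOriented d) ∧ ∃ i, |d.spin i| = d.mass i) → ¬ ∃ (O' : Set 𝒟.carrier) (d' : Literature.Geometry.Lorentzian.FinalStateDecomposition 𝒟.toSpacetime O' 2), (∀ i, Literature.Geometry.Lorentzian.Kerr.IsSubextremal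 (d'.mass i) (d'.spin i)) ∧ O' = Summit.FinalStateConjecture.exteriorOf 𝒟.toCauchyDevelopment d'.charted ∧ Summit.FinalStateConjecture.RaysStayInClosure 𝒟.toCauchyDevelopment O' ∧ Summit.FinalStateConjecture.HasExhaustiveCharts d' ∧ Summit.FinalStateConjecture.IsFutureOriented d'

/-! ### Statements of the registered stubs, under the stub names
The skeleton audit reads the hypotheses of `LaminatedThreshold_of` BY NAME: each head is a declared stub. -/
namespace Goal

/-- Statement of `stub_extremalComb`. -/
abbrev stub_extremalComb : Prop := ExtremalComb
/-- Statement of `stub_extremalLeafNotGood`. -/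
abbrev stub_extremalLeafNotGood : Prop := ExtremalLeafNotGood

end Goal

/-! ## §2 Registered stubs (the two `sorry`s of the file), stated EXPANDED over existing declarations
(Statement + Literature prelude only; no vocabulary of this file occurs in a stub signature). -/

/-- **Stub 1** (open-problem): the extremal comb — see `ExtremalComb`.
[cite: Dafermos2025GRG, §6.4] [cite: KehleUnger2024, Conj. 5] -/
theorem stub_extremalComb :
    ∃ (X : Type) (_ : TopologicalSpace X) (_ : ChartedSpace Literature.Geometry.Lorentzian.E3 X) (_ : IsManifold (𝓡 3) ((⊤ : ℕ∞) : WithTop ℕ∞) X) (_ : T2Space X) (_ : SecondCountableTopology X) (_ : ConnectedSpace X) (dstar : Literature.Geometry.Lorentzian.InitialDataSet (𝓡 3) X) (Φ : Literature.Geometry.Lorentzian.InitialDataSet (𝓡 3) X → ℝ) (K : Set ℝ), dstar ∈ Literature.Geometry.Lorentzian.admissibleVacuumData X ∧ Φ dstar ∈ K ∧ (∀ ε : ℝ, 0 < ε → (K ∩ Set.Ioo (Φ dstar - ε) (Φ dstar)).Nonempty ∧ (K ∩ Set.Ioo (Φ dstar) (Φ dstar + ε)).Nonempty) ∧ ∀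 F : EuclideanSpace ℝ (Fin 1) → Literature.Geometry.Lorentzian.InitialDataSet (𝓡 3) X, Literature.Geometry.Lorentzian.InitialDataSet.IsSmoothDataFamily 1 F → F 0 = dstar → (∀ c, F c ∈ Literature.Geometry.Lorentzian.admissibleVacuumData X) → (∃ C : Set X, IsCompact C ∧ ∀ c, ∀ x ∉ C, (F c).h.inner x = dstar.h.inner x ∧ (F c).k x = dstar.k x) → ∃ δ : ℝ, 0 < δ ∧ ContinuousOn (fun c ↦ Φ (F c)) (Metric.ball 0 δ) ∧ ∀ c ∈ Metric.ball (0 : EuclideanSpace ℝ (Fin 1)) δ, Φ (F c) ∈ K → ∃ 𝒟 : Literature.Geometry.Lorentzian.VacuumCauchyDevelopment (F c), 𝒟.IsMaximal ∧ ∃ (O : Set 𝒟.carrier) (d : Literature.Geometry.Lorentzian.FinalStateDecomposition 𝒟.toSpacetime O 2), (O = Summit.FinalStateConjecture.exteriorOf 𝒟.toCauchyDevelopment d.charted ∧ Summit.FinalStateConjecture.RaysStayInClosure 𝒟.toCauchyDevelopment O ∧ Summit.FinalStateConjecture.HasExhaustiveCharts d ∧ Summit.FinalStateConjecture.IsFutureOriented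 d) ∧ ∃ i, |d.spin i| = d.mass i := by
  sorry

/-- **Stub 2** (L–XL): extremal leaves are not good — see `ExtremalLeafNotGood`.
[cite: DafermosLuk2017, Conjecture 1] [cite: Dafermos2025GRG, §6.4] -/
theorem stub_extremalLeafNotGood :
    ∀ (X : Type) [TopologicalSpace X] [ChartedSpace Literature.Geometry.Lorentzian.E3 X] [IsManifold (𝓡 3) ((⊤ : ℕ∞) : WithTop ℕ∞) X] [T2Space X] [SecondCountableTopology X] [ConnectedSpace X], ∀ D ∈ Literature.Geometry.Lorentzian.admissibleVacuumData X, ∀ 𝒟 : Literature.Geometry.Lorentzian.VacuumCauchyDevelopment D, 𝒟.IsMaximal → (∃ (O : Set 𝒟.carrier) (d : Literature.Geometry.Lorentzian.FinalStateDecomposition 𝒟.toSpacetime O 2), (O = Summit.FinalStateConjecture.exteriorOf 𝒟.toCauchyDevelopment d.charted ∧ Summit.FinalStateConjecture.RaysStayInClosure 𝒟.toCauchyDevelopment O ∧ Summit.FinalStateConjecture.HasExhaustiveCharts d ∧ Summit.FinalStateConjecture.IsFutureOriented d) ∧ ∃ i, |d.spin i| = d.mass i) → ¬ ∃ (O' :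 Set 𝒟.carrier) (d' : Literature.Geometry.Lorentzian.FinalStateDecomposition 𝒟.toSpacetime O' 2), (∀ i, Literature.Geometry.Lorentzian.Kerr.IsSubextremal (d'.mass i) (d'.spin i)) ∧ O' = Summit.FinalStateConjecture.exteriorOf 𝒟.toCauchyDevelopment d'.charted ∧ Summit.FinalStateConjecture.RaysStayInClosure 𝒟.toCauchyDevelopment O' ∧ Summit.FinalStateConjecture.HasExhaustiveCharts d' ∧ Summit.FinalStateConjecture.IsFutureOriented d' := by
  sorry

/-! ## §3 The composition (kernel-checked; no `sorry` of its own) -/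

section Composition

variable {X : Type} [TopologicalSpace X] [ChartedSpace E3 X] [IsManifold (𝓡 3) ∞ X] [T2Space X]
  [SecondCountableTopology X] [ConnectedSpace X]

/-- The key conversion: under Stub 2, an admissible datum that SETTLES EXTREMALLY is EXCEPTIONAL (not
good): goodness evaluated at the very development carrying the extremal honest decomposition would give a
sub-extremal honest decomposition of the same development. [folklore] -/
theorem not_isGood_of_settlesExtremal (hE : ExtremalLeafNotGood) {D : InitialDataSet (𝓡 3) X}
    (hD : D ∈ admissibleVacuumData X) (hext : SettlesExtremal D) : ¬ IsGood D := by
  rintro ⟨-, hall⟩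
  obtain ⟨𝒟, h𝒟, O, d, hhon, i, hi⟩ := hext
  obtain ⟨-, O', d', hsub, hO', hrays, hexh, hfut⟩ := hall 𝒟 h𝒟
  exact hE X D hD 𝒟 h𝒟 ⟨O, d, hhon, i, hi⟩ ⟨O', d', hsub, hO', hrays, hexh, hfut⟩

end Composition

/-- **THE CRUX BY NAME** from the two registered stubs. From Stub 1 take `X, d⋆, Φ, K`; Stub 2 makes
every extremally-settling admissible datum of `X` exceptional (`not_isGood_of_settlesExtremal`); the
crux's conjunct "`d⋆` is exceptional" is obtained from the saturation clause along the CONSTANT family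
through `d⋆` (`InitialDataSet.isSmoothDataFamily_const`; it agrees with `d⋆` off the empty compact set and
`Φ d⋆ ∈ K`); the family clause is Stub 1's, pushed through the conversion. [folklore] -/
theorem LaminatedThreshold_of :
    Goal.stub_extremalComb → Goal.stub_extremalLeafNotGood → LaminatedThreshold := by
  intro hA hE
  obtain ⟨X, i₁, i₂, i₃, i₄, i₅, i₆, dstar, Φ, K, hadm, hK, hacc, hsat⟩ := hA
  -- settles-extremal ⇒ exceptional at every admissible datum of `X`
  have key : ∀ D ∈ admissibleVacuumData X, SettlesExtremal D → ¬ IsGood D :=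
    fun D hD hext ↦ not_isGood_of_settlesExtremal hE hD hext
  refine ⟨X, i₁, i₂, i₃, i₄, i₅, i₆, dstar, Φ, K, hadm, ?_, hK, hacc, ?_⟩
  · -- `d⋆` is exceptional: saturation along the constant family through `d⋆`
    obtain ⟨δ, hδ, -, hext⟩ := hsat (fun _ ↦ dstar) (InitialDataSet.isSmoothDataFamily_const 1 dstar)
      rfl (fun _ ↦ hadm) ⟨∅, isCompact_empty, fun _ _ _ ↦ ⟨rfl, rfl⟩⟩
    exact key dstar hadm (hext 0 (Metric.mem_ball_self hδ) hK)
  · -- the family clause: Stub 1's clause, extremal settling converted into exceptionality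
    intro F hF h0 hFadm hC
    obtain ⟨δ, hδ, hcont, hext⟩ := hsat F hF h0 hFadm hC
    exact ⟨δ, hδ, hcont, fun c hc hcK ↦ key (F c) (hFadm c) (hext c hc hcK)⟩

/-! ### Consistency: each registered stub, stated EXPANDED, IS the named statement of §1. -/

theorem extremalComb_holds : ExtremalComb := stub_extremalComb
theorem extremalLeafNotGood_holds : ExtremalLeafNotGood := stub_extremalLeafNotGood

/-- **The crux from the skeleton** (closed modulo the two `sorry`s). [folklore] -/
theorem LaminatedThreshold_proof : LaminatedThreshold :=
  LaminatedThreshold_of stub_extremalComb stub_extremalLeafNotGood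

/-! ### Sanity (no `sorry`): what Stub 1 needs at `c = 0`.
Stub 1 can only be witnessed at a base point `d⋆` that is an ADMISSIBLE VACUUM DATUM SETTLING EXTREMALLY
(constant family, `Φ d⋆ ∈ K`) — the object of Kehle–Unger's Conjecture 5 (vacuum extremal critical
collapse), which no declaration of the tree or of `Literature/` provides. -/

/-- Stub 1 exhibits an admissible vacuum datum that settles extremally (its base point, read off the
constant family). [folklore] -/
theorem exists_settlesExtremal_of_extremalComb (h : ExtremalComb) :
    ∃ (X : Type) (_ : TopologicalSpace X) (_ : ChartedSpace E3 X) (_ : IsManifold (𝓡 3) ∞ X)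
      (_ : T2Space X) (_ : SecondCountableTopology X) (_ : ConnectedSpace X)
      (dstar : InitialDataSet (𝓡 3) X), dstar ∈ admissibleVacuumData X ∧ SettlesExtremal dstar := by
  obtain ⟨X, i₁, i₂, i₃, i₄, i₅, i₆, dstar, Φ, K, hadm, hK, -, hsat⟩ := h
  obtain ⟨δ, hδ, -, hext⟩ := hsat (fun _ ↦ dstar) (InitialDataSet.isSmoothDataFamily_const 1 dstar)
    rfl (fun _ ↦ hadm) ⟨∅, isCompact_empty, fun _ _ _ ↦ ⟨rfl, rfl⟩⟩
  exact ⟨X, i₁, i₂, i₃, i₄, i₅, i₆, dstar, hadm, hext 0 (Metric.mem_ball_self hδ) hK⟩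

end Summit.FinalStateConjecture.FinalStateConjecture.Cruxes.LaminatedThreshold.ExtremalComb

end
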